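import Summits.BirchSwinnertonDyer.BirchSwinnertonDyer.Theorems.ByReductionTypeAtTwoTorsionEulerCharH46OfT1
import Literature.NumberTheory.EllipticCurves.RationalTorsionKernelOfReductionCriterion
import HarnessLib

set_option linter.dupNamespace false -- `…BirchSwinnertonDyer.BirchSwinnertonDyer…` is the cell's nested layout (D-0017)
set_option autoImplicit false

/-!
# H46 kernel programme (road C′): the `p = 2` Euler-characteristic display from the ORDER-2 points, and a
# DATABASE-STYLE certificate door (`decide`/`norm_num` obligations only)

Cell `bsd-2adic` (run/shared/lean/pub/bsd-2adic/), seat `bsd-2adic-tower-1` GEN 36; `--supports stmt-BirchSwinnertonDyer-19271`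
(helper, item `OrdKatoHalfAtTwo`, TOWER road); pen RC-505 «door `t1_two_of_torsionPoints_nonintegral`». THEOREMS ONLY; closes no
item; nothing booked; BSD is not proved by any of this.

GEN 35's door `twoAdicEulerCharRankZero_of_forall_valuation_le_one` (file `…H46IntegralTorsion`) asks for the `2`-integrality of the
abscissa of EVERY rational `2`-power-torsion point. Since the kernel of reduction is a subgroup it suffices to ask it of the rational
points `P` with `2 • P = 0`, read in `E(ℚ̄)` (`RationalTorsionKernelOfReduction.t1_of_forall_prime_nsmul_valuation_le_one`); their abscissae are the
rational roots of the `2`-division cubic `ψ₂ = 4x³ + b₂x² + 2b₄x + b₆`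
(`RationalTorsionKernelOfReduction.twoTorsionPolynomial_eval_eq_zero_of_two_nsmul_eq_zero`). Hence:

* `lemma46At_of_forall_prime_nsmul_valuation_le_one` — `H46(W, p, κ, v₀)` from the order-`p` criterion (any good ordinary `p`);
* `twoAdicEulerCharRankZero_of_forall_twoTorsion_valuation_le_one` — `X5.O1.TwoAdicEulerCharRankZero W 0` for every globally
  minimal `W/ℚ` all of whose rational points of order `2` have `2`-integral abscissa;
* `eq_of_twoTorsionPolynomial_cert` — the rational-root certificate: `ψ₂ = (x − x_T)(4x² + αx + β)` with `x_T, α, β ∈ ℤ` and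
  `D = α² − 16β` a non-square (witness `D < 0` or `0 ≤ s`, `s² < D < (s+1)²`) pins every rational root of `ψ₂` to `x_T`;
* `twoAdicEulerCharRankZero_of_twoTorsionCert` / `…_of_twoTorsionCert_baseChange` — the DATABASE-STYLE doors: for
  `W = ⟨a₁, a₂, a₃, a₄, a₆⟩` (integers) resp. `W = M.baseChange ℚ`, integers `x_T, α, β` (and `s`) with the three coefficient identities
  and the non-square witness give `TwoAdicEulerCharRankZero W 0`; every hypothesis is a closed integer (in)equality.

Habitat (tower-1 GEN 36 census `HOME/tower/gen36/T1-AT-2-CENSUS.md`): of the 380 good-ordinary X5 members with a rational point of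
order `2`, exactly the 169 Γ₀(N)-optimal ones (one per class) satisfy the hypothesis; 167 of them carry an `hEC` display.
[cite: GreenbergLNM1716, Thm. 4.1 (p. 102), §4 Lemmas 4.6–4.7 (pp. 105–108)] [cite: SilvermanAEC2009, Prop. VII.2.2, III.2.3(d)]
-/

noncomputable section

open scoped Classical NumberField

namespace Summit.BirchSwinnertonDyer.BirchSwinnertonDyer.Theorems

namespace TorsionEulerChar.H46LevelZero

open CategoryTheory Field NumberField IsDedekindDomain WeierstrassCurve
  Literature.NumberTheory.EllipticCurves Literature.NumberTheory.EllipticCurves.CyclotomicLayer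
  Literature.NumberTheory.EllipticCurves.GreenbergSelmer
  Literature.NumberTheory.GaloisRepresentations Literature.NumberTheory.GaloisRepresentations.DiscreteGaloisModule
  Literature.NumberTheory.GaloisCohomology ZpExtension

/-! ## §1 `H46` and the `p = 2` display from the order-`p` points -/

/-- **`H46(W, p, κ, v₀)` from the ORDER-`p` coordinate criterion**: `lemma46At_of_T1` with (T₁) discharged by
`RationalTorsionKernelOfReduction.t1_of_forall_prime_nsmul_toGeomPoints_valuation_le_one` (every rational affine point `P` of the
globally minimal `W` with `p • P = 0` in `E(ℚ̄)` has `p`-integral abscissa). [cite: GreenbergLNM1716, §4 Lemma 4.6 (p. 105)] [cite: SilvermanAEC2009, Prop. VII.2.2] -/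
theorem lemma46At_of_forall_prime_nsmul_valuation_le_one (W : WeierstrassCurve ℚ) [W.IsElliptic] [W.IsGloballyMinimal] (p : ℕ)
    [hp : Fact p.Prime] (κ : ZpExtension ℚ p) (hκ : κ.IsCyclotomic) (hord : IsOrdinaryAt W p)
    (S : Finset (HeightOneSpectrum (𝓞 ℚ)))
    (hS : ∀ v : HeightOneSpectrum (𝓞 ℚ), v ∉ S → ((p : ℕ) : 𝓞 ℚ) ∉ v.asIdeal ∧ W.HasGoodReductionAt v)
    (v₀ : HeightOneSpectrum (𝓞 ℚ)) (hv₀ : v₀ ∉ S) (vp : HeightOneSpectrum (𝓞 ℚ)) (hvp : ((p : ℕ) : 𝓞 ℚ) ∈ vp.asIdeal)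
    [Finite (W.selmerGroupPInfty p)]
    (H : ∀ (x₀ y₀ : ℚ) (h : W.toAffine.Nonsingular x₀ y₀),
      p • WeierstrassCurve.toGeomPoints W (.some x₀ y₀ h) = 0 → vp.valuation ℚ x₀ ≤ 1)
    (z : discreteH1 (localSubgroup (⊤ : Subgroup (absoluteGaloisGroup ℚ)) (v₀.adicCompletion ℚ))
      (localPoints W (v₀.adicCompletion ℚ))) (hz : ∃ k : ℕ, p ^ k • z = 0) :
    ∃ T : W.subgroupH1 p κ.kerSubgroup,
      (∀ v : HeightOneSpectrum (𝓞 ℚ), v ≠ v₀ → ∀ σ : absoluteGaloisGroup ℚ,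
        W.conjH1 p κ.kerSubgroup σ T ∈ W.localKerOver p κ.kerSubgroup (v.adicCompletion ℚ)) ∧
      (∀ (w : InfinitePlace ℚ) (σ : absoluteGaloisGroup ℚ),
        W.conjH1 p κ.kerSubgroup σ T ∈ W.localKerOver p κ.kerSubgroup w.Completion) ∧
      ∀ σ : absoluteGaloisGroup ℚ,
        W.localResOver p κ.kerSubgroup (v₀.adicCompletion ℚ) (W.conjH1 p κ.kerSubgroup σ T) =
          Literature.NumberTheory.EllipticCurves.resOfLe (localPoints W (v₀.adicCompletion ℚ))
            (Subgroup.comap_mono le_top :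
              localSubgroup κ.kerSubgroup (v₀.adicCompletion ℚ) ≤
                localSubgroup (⊤ : Subgroup (absoluteGaloisGroup ℚ)) (v₀.adicCompletion ℚ)) z :=
  lemma46At_of_T1 W p κ hκ hord S hS v₀ hv₀ vp hvp
    (RationalTorsionKernelOfReduction.t1_of_forall_prime_nsmul_toGeomPoints_valuation_le_one W vp p H) z hz

open Summit.BirchSwinnertonDyer.Rank1Residual.X5.O1 in
/-- **`p = 2`: the display `TwoAdicEulerCharRankZero W 0` from the ORDER-2 points** — for a globally minimal `W/ℚ`, if every
rational affine point `P = (x₀, y₀)` with `2 • P = 0` has `2`-integral `x₀` then Greenberg's rank-0 Euler-characteristic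
display at `2` holds (`twoAdicEulerCharRankZero_of_T1` + `t1_of_forall_prime_nsmul_toGeomPoints_valuation_le_one`). Rational `2`-power torsion
of any order is allowed. [cite: GreenbergLNM1716, Thm. 4.1 (p. 102), §4 Lemmas 4.6–4.7 (pp. 105–108)] [cite: SilvermanAEC2009, Prop. VII.2.2] -/
theorem twoAdicEulerCharRankZero_of_forall_twoTorsion_valuation_le_one (W : WeierstrassCurve ℚ) [W.IsElliptic]
    [W.IsGloballyMinimal] (v2 : HeightOneSpectrum (𝓞 ℚ)) (hv2 : ((2 : ℕ) : 𝓞 ℚ) ∈ v2.asIdeal)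
    (H : ∀ (x₀ y₀ : ℚ) (h : W.toAffine.Nonsingular x₀ y₀),
      2 • WeierstrassCurve.toGeomPoints W (.some x₀ y₀ h) = 0 → v2.valuation ℚ x₀ ≤ 1) :
    TwoAdicEulerCharRankZero W 0 :=
  twoAdicEulerCharRankZero_of_T1 W v2 hv2
    (RationalTorsionKernelOfReduction.t1_of_forall_prime_nsmul_toGeomPoints_valuation_le_one W v2 2 H)

/-! ## §2 The rational-root certificate for `ψ₂` and the database-style doors -/

/-- **Rational-root certificate for the `2`-division cubic over `ℚ`.** If `ψ₂ = 4x³ + b₂x² + 2b₄x + b₆` (integer `bᵢ`) factors as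
`(x − x_T)(4x² + αx + β)` with `x_T, α, β ∈ ℤ` (`α = b₂ + 4x_T`, `β = 2b₄ + αx_T`, `−βx_T = b₆`) and `D = α² − 16β` is not a square
(witness: `D < 0`, or `0 ≤ s` with `s² < D < (s+1)²`), then every rational root of `ψ₂` equals `x_T`: a rational root of the
quadratic factor would give `D = (8x + α)²`, a rational — hence integral — square strictly between consecutive squares. [folklore] -/
theorem eq_of_twoTorsionPolynomial_cert (b₂ b₄ b₆ xT α β : ℤ) (hα : α = b₂ + 4 * xT) (hβ : β = 2 * b₄ + α * xT)
    (h6 : -(β * xT) = b₆)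
    (hD : α ^ 2 - 16 * β < 0 ∨ ∃ s : ℤ, 0 ≤ s ∧ s ^ 2 < α ^ 2 - 16 * β ∧ α ^ 2 - 16 * β < (s + 1) ^ 2)
    {x : ℚ} (hx : 4 * x ^ 3 + b₂ * x ^ 2 + 2 * b₄ * x + b₆ = 0) : x = xT := by
  have hfac : ((x : ℚ) - xT) * (4 * x ^ 2 + α * x + β) = 0 := by
    have h6' : ((b₆ : ℤ) : ℚ) = -((β : ℚ) * xT) := by exact_mod_cast h6.symm
    have hα' : ((α : ℤ) : ℚ) = b₂ + 4 * xT := by exact_mod_cast hα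
    have hβ' : ((β : ℤ) : ℚ) = 2 * b₄ + α * xT := by exact_mod_cast hβ
    rw [h6'] at hx
    linear_combination hx + x ^ 2 * hα' + x * hβ'
  rcases mul_eq_zero.1 hfac with h1 | hq
  · exact sub_eq_zero.1 h1
  · exfalso
    -- `D = q²` with `q = 8x + α ∈ ℚ`
    have hsq : ((α ^ 2 - 16 * β : ℤ) : ℚ) = (8 * x + α) ^ 2 := by
      push_cast
      linear_combination (-16 : ℚ) * hq
    set q : ℚ := 8 * x + (α : ℚ) with hq_def
    rcases hD with hneg | ⟨s, hs0, hs1, hs2⟩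
    · have : (0 : ℚ) ≤ ((α ^ 2 - 16 * β : ℤ) : ℚ) := by rw [hsq]; positivity
      exact absurd (by exact_mod_cast this) (not_le.2 hneg)
    · -- `q` is an integer: its denominator squared is the denominator of the integer `D`
      have hden : q.den = 1 := by
        have h1 : (q ^ 2).den = 1 := by rw [← hsq]; exact Rat.den_intCast _
        rw [Rat.den_pow] at h1
        exact (pow_eq_one_iff.1 h1).resolve_right (by norm_num)
      have hqn : (q.num : ℚ) = q := Rat.coe_int_num_of_den_eq_one hden
      have hD : α ^ 2 - 16 * β = q.num ^ 2 := by
        have : ((α ^ 2 - 16 * β : ℤ) : ℚ) = ((q.num ^ 2 : ℤ) : ℚ) := by rw [hsq]; push_cast; rw [hqn]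
        exact_mod_cast this
      rw [hD] at hs1 hs2
      have h1 : s < |q.num| := by
        have h := sq_lt_sq.1 hs1
        rwa [abs_of_nonneg hs0] at h
      have h2 : |q.num| < s + 1 := by
        have h := sq_lt_sq.1 hs2
        rwa [abs_of_nonneg (by linarith : (0 : ℤ) ≤ s + 1)] at h
      exact absurd (Int.lt_add_one_iff.1 h2) (not_le.2 h1)


/-- A place of `ℚ` above `2` exists (plumbing). [folklore] -/
private theorem exists_heightOneSpectrum_two_mem :
    ∃ v2 : HeightOneSpectrum (𝓞 ℚ), ((2 : ℕ) : 𝓞 ℚ) ∈ v2.asIdeal := by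
  have hne : Ideal.span {((2 : ℕ) : 𝓞 ℚ)} ≠ ⊤ := by
    rw [Ne, Ideal.span_singleton_eq_top]
    intro hu
    have h := hu.map (Rat.IsIntegralClosure.intEquiv (𝓞 ℚ))
    rw [map_natCast, Int.isUnit_iff_natAbs_eq, Int.natAbs_natCast] at h
    exact absurd h (by norm_num)
  obtain ⟨𝔪, h𝔪, hle⟩ := Ideal.exists_le_maximal _ hne
  have h𝔪0 : 𝔪 ≠ ⊥ := by
    intro h0
    rw [h0, le_bot_iff, Ideal.span_singleton_eq_bot] at hle
    exact absurd hle (by norm_num)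
  exact ⟨⟨𝔪, h𝔪.isPrime, h𝔪0⟩, hle (Ideal.mem_span_singleton_self _)⟩

/-- The `v`-adic valuation of a rational INTEGER is `≤ 1` at every finite place `v` of `ℚ`. [folklore] -/
private theorem valuation_intCast_le_one (v : HeightOneSpectrum (𝓞 ℚ)) (n : ℤ) : v.valuation ℚ (n : ℚ) ≤ 1 := by
  simpa using HeightOneSpectrum.valuation_le_one (K := ℚ) v (n : 𝓞 ℚ)

open Summit.BirchSwinnertonDyer.Rank1Residual.X5.O1 in
/-- **DATABASE-STYLE DOOR (literal model).** For a globally minimal elliptic `W = ⟨a₁, a₂, a₃, a₄, a₆⟩` over `ℚ` with INTEGER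
coefficients and integers `x_T, α, β` such that `α = a₁² + 4a₂ + 4x_T` (`= b₂ + 4x_T`), `β = 2(2a₄ + a₁a₃) + αx_T` (`= 2b₄ + αx_T`),
`−βx_T = a₃² + 4a₆` (`= b₆`) — i.e. `ψ₂ = (x − x_T)(4x² + αx + β)` — and `α² − 16β` is a non-square (`< 0`, or strictly between
`s²` and `(s+1)²` for some `s ≥ 0`): every rational point of order `2` has abscissa `x_T ∈ ℤ`, so `TwoAdicEulerCharRankZero W 0`.
All hypotheses are closed integer (in)equalities (`decide` / `norm_num`). [cite: GreenbergLNM1716, Thm. 4.1 (p. 102)]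
[cite: SilvermanAEC2009, Prop. VII.2.2, III.2.3(d)] -/
theorem twoAdicEulerCharRankZero_of_twoTorsionCert (W : WeierstrassCurve ℚ) [W.IsElliptic] [W.IsGloballyMinimal]
    (a₁ a₂ a₃ a₄ a₆ xT α β : ℤ) (hW : W = ⟨a₁, a₂, a₃, a₄, a₆⟩)
    (hα : α = a₁ ^ 2 + 4 * a₂ + 4 * xT) (hβ : β = 2 * (2 * a₄ + a₁ * a₃) + α * xT)
    (h6 : -(β * xT) = a₃ ^ 2 + 4 * a₆)
    (hD : α ^ 2 - 16 * β < 0 ∨ ∃ s : ℤ, 0 ≤ s ∧ s ^ 2 < α ^ 2 - 16 * β ∧ α ^ 2 - 16 * β < (s + 1) ^ 2) :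
    TwoAdicEulerCharRankZero W 0 := by
  obtain ⟨v2, hv2⟩ := exists_heightOneSpectrum_two_mem
  refine twoAdicEulerCharRankZero_of_forall_twoTorsion_valuation_le_one W v2 hv2 fun x₀ y₀ h h2 ↦ ?_
  have hψ := RationalTorsionKernelOfReduction.twoTorsionPolynomial_eval_eq_zero_of_two_nsmul_toGeomPoints_eq_zero W h h2
  subst hW
  simp only [WeierstrassCurve.b₂, WeierstrassCurve.b₄, WeierstrassCurve.b₆] at hψ
  have hx : 4 * x₀ ^ 3 + ((a₁ ^ 2 + 4 * a₂ : ℤ) : ℚ) * x₀ ^ 2 + 2 * ((2 * a₄ + a₁ * a₃ : ℤ) : ℚ) * x₀ +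
      ((a₃ ^ 2 + 4 * a₆ : ℤ) : ℚ) = 0 := by
    push_cast
    linear_combination hψ
  rw [eq_of_twoTorsionPolynomial_cert (a₁ ^ 2 + 4 * a₂) (2 * a₄ + a₁ * a₃) (a₃ ^ 2 + 4 * a₆) xT α β hα hβ h6 hD hx]
  exact valuation_intCast_le_one v2 xT

open Summit.BirchSwinnertonDyer.Rank1Residual.X5.O1 in
/-- **DATABASE-STYLE DOOR (integer model).** The same for `W = M.baseChange ℚ`, `M = ⟨a₁, …, a₆⟩` a Weierstrass equation over `ℤ`
(the cell's `cLABEL := MLABEL.baseChange ℚ` convention), with the certificate read on `M.b₂, M.b₄, M.b₆`: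
`α = M.b₂ + 4x_T`, `β = 2M.b₄ + αx_T`, `−βx_T = M.b₆`, `α² − 16β` a non-square. [cite: GreenbergLNM1716, Thm. 4.1 (p. 102)]
[cite: SilvermanAEC2009, Prop. VII.2.2, III.2.3(d)] -/
theorem twoAdicEulerCharRankZero_of_twoTorsionCert_baseChange (M : WeierstrassCurve ℤ) [(M.baseChange ℚ).IsElliptic]
    [(M.baseChange ℚ).IsGloballyMinimal] (xT α β : ℤ)
    (hα : α = M.b₂ + 4 * xT) (hβ : β = 2 * M.b₄ + α * xT) (h6 : -(β * xT) = M.b₆)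
    (hD : α ^ 2 - 16 * β < 0 ∨ ∃ s : ℤ, 0 ≤ s ∧ s ^ 2 < α ^ 2 - 16 * β ∧ α ^ 2 - 16 * β < (s + 1) ^ 2) :
    TwoAdicEulerCharRankZero (M.baseChange ℚ) 0 := by
  obtain ⟨v2, hv2⟩ := exists_heightOneSpectrum_two_mem
  refine twoAdicEulerCharRankZero_of_forall_twoTorsion_valuation_le_one (M.baseChange ℚ) v2 hv2 fun x₀ y₀ h h2 ↦ ?_
  have hψ :=
    RationalTorsionKernelOfReduction.twoTorsionPolynomial_eval_eq_zero_of_two_nsmul_toGeomPoints_eq_zero (M.baseChange ℚ) h h2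
  have hb₂ : (M.baseChange ℚ).b₂ = (M.b₂ : ℚ) := by simp [WeierstrassCurve.baseChange]
  have hb₄ : (M.baseChange ℚ).b₄ = (M.b₄ : ℚ) := by simp [WeierstrassCurve.baseChange]
  have hb₆ : (M.baseChange ℚ).b₆ = (M.b₆ : ℚ) := by simp [WeierstrassCurve.baseChange]
  rw [hb₂, hb₄, hb₆] at hψ
  rw [eq_of_twoTorsionPolynomial_cert M.b₂ M.b₄ M.b₆ xT α β hα hβ h6 hD hψ]
  exact valuation_intCast_le_one v2 xT

end TorsionEulerChar.H46LevelZero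

end Summit.BirchSwinnertonDyer.BirchSwinnertonDyer.Theorems
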